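import Summits.AtomisticToContinuum.BoseEinsteinCondensation.Theorems.BECGroundStateSOSPeriodicIRBoundDefs
import Summits.AtomisticToContinuum.BoseEinsteinCondensation.Theorems.BECGroundStateSOSPeriodicIRBoundWFDefs
import Summits.AtomisticToContinuum.BoseEinsteinCondensation.Theorems.BECGroundStateSOSPeriodicIRBoundWFComFourier
import Literature.MathematicalPhysics.QuantumManyBody.PeriodicBoseGasMomentumSector
import Literature.MathematicalPhysics.QuantumManyBody.PeriodicConfigFourier
import Literature.MathematicalPhysics.QuantumManyBody.PeriodicBoseGasEq317
import Literature.MathematicalPhysics.QuantumManyBody.PeriodicBoseGasLemma33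
import Literature.MathematicalPhysics.QuantumManyBody.PeriodicBoseGasImpurityTranslation
import Literature.MathematicalPhysics.QuantumManyBody.PeriodicCondensateCoherence
import Literature.MathematicalPhysics.QuantumManyBody.CoarseModeRayPOVMFormCore
import HarnessLib

/-! # Crux `PeriodicIRBound` (stmt-AtomisticToContinuum-3972), line `linear-ph-floor-wagner`, stub 5b `stub_wagnerFeynman` — ComFourier2
E1 (part 2): Parseval for the centre-of-mass components (norm, potential and kinetic forms), `∂(Ψ_q) = (∂Ψ)_q`. -/

/-!

Parseval for the centre-of-mass Fourier components `Ψ_q = comCoeff L Ψ q` of `WFComFourier.lean`: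
for a continuous `Ψ` that is `Lℤ³`-periodic in every particle and a measurable weight `W ≥ 0` that is
periodic in every particle and invariant under the simultaneous translation of all particles,
`∑_q ∫_{cell^M} W |Ψ_q|² = ∫_{cell^M} W |Ψ|²` (Parseval on the cell in the centre-of-mass variable for each
`X`, Tonelli, shift invariance of the `cell^M`-integral of periodic integrands); the cases `W = 1` (norm),
`W = ∑_{i<j} w^per(xᵢ - xⱼ)` (potential energy) and, through the derivative formula `∂(Ψ_q) = (∂Ψ)_q`
(differentiation under the integral sign), the kinetic energy.

`FROM WFComFourier.lean` (duplicated here as private `_aux` lemmas, so that the two files concatenate).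
-/

noncomputable section

open scoped BigOperators ENNReal ComplexConjugate
open Filter MeasureTheory

namespace Summit.AtomisticToContinuum.BoseEinsteinCondensation.Cruxes.PeriodicIRBound.LinearPhFloorWagner.WF

open Literature.MathematicalPhysics.QuantumManyBody.BoseGas

variable {M : ℕ} {L : ℝ}

-- `comCoeff` is the §E definition of WFPlan.lean (verbatim, as in WFComFourier.lean); it is NOT part of
-- the Defs module's §2b vocabulary. On concatenation with WFComFourier.lean delete this copy (and the
-- block above).

-- `comCoeff_eq_integral`, `contDiff_comIntegrand` of that file (nothing to delete on concatenation).

/-- The slice `s ↦ Ψ(X + s·𝟙)` of a continuous function is continuous. [folklore] -/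
private theorem continuous_comSlice_aux {Ψ : Config M → ℂ} (hΨ : Continuous Ψ) (X : Config M) :
    Continuous fun s : Space => Ψ (fun i => X i + s) :=
  hΨ.comp (continuous_pi fun _ => continuous_const.add continuous_id)

/-- `Ψ_q(X) = L⁻³ ∫_{[0,L)³} e_{-q}(s) Ψ(X + s·𝟙) ds`. [folklore] -/
private theorem comCoeff_eq_integral_aux (hL : 0 < L) (Ψ : Config M → ℂ) (q : Fin 3 → ℤ) (X : Config M) :
    comCoeff L Ψ q X =
      (((L ^ 3)⁻¹ : ℝ) : ℂ) * ∫ s in cell L, cellWave L (-q) s * Ψ (fun i => X i + s) := by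
  rw [comCoeff, cellFourierCoeff_eq_integral hL, Complex.real_smul]
  simp only [conj_cellWave]

/-- The integrand `(s, X) ↦ e_{-q}(s) Ψ(X + s·𝟙)` of `Ψ_q` is `C¹` when `Ψ` is. [folklore] -/
private theorem contDiff_comIntegrand_aux {Ψ : Config M → ℂ} (hΨ : ContDiff ℝ 1 Ψ) (q : Fin 3 → ℤ) :
    ContDiff ℝ 1 fun p : Space × Config M => cellWave L (-q) p.1 * Ψ (fun i => p.2 i + p.1) := by
  have hA : ContDiff ℝ 1 fun p : Space × Config M => (fun i => p.2 i + p.1 : Config M) :=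
    contDiff_pi.2 fun i => ((contDiff_apply ℝ Space i).comp contDiff_snd).add contDiff_fst
  exact (((contDiff_cellWave L (-q)).of_le (mod_cast le_top)).comp contDiff_fst).mul (hΨ.comp hA)

/-! ### Continuity of the components in the configuration -/

/-- `(X, s) ↦ X + s·𝟙` is continuous. [folklore] -/
theorem continuous_comShift_left (M : ℕ) :
    Continuous fun p : Config M × Space => (fun i => p.1 i + p.2 : Config M) :=
  continuous_pi fun i => ((continuous_apply i).comp continuous_fst).add continuous_snd

/-- `(s, X) ↦ X + s·𝟙` is continuous. [folklore] -/
theorem continuous_comShift_right (M : ℕ) :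
    Continuous fun p : Space × Config M => (fun i => p.2 i + p.1 : Config M) :=
  continuous_pi fun i => ((continuous_apply i).comp continuous_snd).add continuous_fst

/-- **`Ψ_q` is continuous when `Ψ` is** (a parametric integral of a jointly continuous integrand over
the bounded cell). [folklore] -/
theorem continuous_comCoeff (hL : 0 < L) {Φ : Config M → ℂ} (hc : Continuous Φ) (q : Fin 3 → ℤ) :
    Continuous (comCoeff L Φ q) := by
  have hG : Continuous fun p : Space × Config M => cellWave L (-q) p.1 * Φ (fun i => p.2 i + p.1) :=
    ((continuous_cellWave L (-q)).comp continuous_fst).mul (hc.comp (continuous_comShift_right M))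
  have h := continuous_parametric_setIntegral_of_isBounded (μ := (volume : Measure Space))
    (isBounded_cell L) (measurableSet_cell L) hG
  have heq : comCoeff L Φ q = fun X => (((L ^ 3)⁻¹ : ℝ) : ℂ) *
      ∫ s in cell L, cellWave L (-q) s * Φ (fun i => X i + s) :=
    funext fun X => comCoeff_eq_integral_aux hL Φ q X
  rw [heq]
  exact continuous_const.mul h

/-! ### Parseval for the centre-of-mass components -/

/-- **Weighted Parseval for the centre-of-mass components.** For a continuous `Φ` that is
`Lℤ³`-periodic in every particle and a measurable weight `W` that is periodic in every particle and
invariant under simultaneous translation of all particles,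
`∑_q ∫_{cell^M} W |Φ_q|² = ∫_{cell^M} W |Φ|²`: Parseval on the cell in `s` for each `X`
(`tsum_sq_cellFourierCoeff`), Tonelli, and shift invariance of the `cell^M`-integral of the periodic
`X ↦ W(X) |Φ(X + s·𝟙)|²` (`lintegral_cellN_comp_add`). [folklore] -/
theorem tsum_lintegral_mul_sq_comCoeff (hL : 0 < L) {Φ : Config M → ℂ} (hc : Continuous Φ)
    (hper : IsTorusPeriodic L Φ) {Wt : Config M → ℝ≥0∞} (hW : Measurable Wt)
    (hWper : IsTorusPeriodic L Wt) (hWinv : ∀ (X : Config M) (s : Space), Wt (fun i => X i + s) = Wt X) :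
    ∑' q : Fin 3 → ℤ, ∫⁻ X in cellN M L, Wt X * ((‖comCoeff L Φ q X‖₊ : ℝ≥0∞)) ^ 2 =
      ∫⁻ X in cellN M L, Wt X * ((‖Φ X‖₊ : ℝ≥0∞)) ^ 2 := by
  have hL3 : (ENNReal.ofReal L ^ 3) ≠ 0 := pow_ne_zero _ (by simpa using hL)
  have hL3' : (ENNReal.ofReal L ^ 3) ≠ ⊤ := ENNReal.pow_ne_top ENNReal.ofReal_ne_top
  -- measurability of the summands and the slices
  have hmeas : ∀ q, Measurable fun X => Wt X * ((‖comCoeff L Φ q X‖₊ : ℝ≥0∞)) ^ 2 := fun q =>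
    hW.mul ((continuous_comCoeff hL hc q).measurable.nnnorm.coe_nnreal_ennreal.pow_const _)
  have hslice : ∀ X : Config M, Measurable fun s : Space => ((‖Φ (fun i => X i + s)‖₊ : ℝ≥0∞)) ^ 2 :=
    fun X => (continuous_comSlice_aux hc X).measurable.nnnorm.coe_nnreal_ennreal.pow_const _
  have hjoint : Measurable fun p : Config M × Space =>
      Wt p.1 * ((‖Φ (fun i => p.1 i + p.2)‖₊ : ℝ≥0∞)) ^ 2 :=
    (hW.comp measurable_fst).mul
      ((hc.comp (continuous_comShift_left M)).measurable.nnnorm.coe_nnreal_ennreal.pow_const _)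
  -- `∑_q ∫ = ∫ ∑_q`, then Parseval in `s` for every fixed `X`
  rw [← lintegral_tsum fun q => (hmeas q).aemeasurable]
  have hpt : ∀ X : Config M, ∑' q, Wt X * ((‖comCoeff L Φ q X‖₊ : ℝ≥0∞)) ^ 2 =
      (ENNReal.ofReal L ^ 3)⁻¹ * ∫⁻ s in cell L, Wt X * ((‖Φ (fun i => X i + s)‖₊ : ℝ≥0∞)) ^ 2 := by
    intro X
    have h : ∑' q, ((‖comCoeff L Φ q X‖₊ : ℝ≥0∞)) ^ 2 =
        (ENNReal.ofReal L ^ 3)⁻¹ * ∫⁻ s in cell L, ((‖Φ (fun i => X i + s)‖₊ : ℝ≥0∞)) ^ 2 :=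
      tsum_sq_cellFourierCoeff hL (continuous_comSlice_aux hc X)
    rw [ENNReal.tsum_mul_left, h, lintegral_const_mul _ (hslice X)]
    ring
  simp_rw [hpt]
  -- Tonelli and shift invariance of the configuration integral
  rw [lintegral_const_mul' _ _ (ENNReal.inv_ne_top.2 hL3),
    lintegral_lintegral_swap
      (f := fun (X : Config M) (s : Space) => Wt X * ((‖Φ (fun i => X i + s)‖₊ : ℝ≥0∞)) ^ 2)
      hjoint.aemeasurable]
  have hinner : ∀ s : Space,
      ∫⁻ X in cellN M L, Wt X * ((‖Φ (fun i => X i + s)‖₊ : ℝ≥0∞)) ^ 2 =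
        ∫⁻ X in cellN M L, Wt X * ((‖Φ X‖₊ : ℝ≥0∞)) ^ 2 := by
    intro s
    have hG : ∀ (X : Config M) (i : Fin M) (k : Fin 3),
        (fun X => Wt X * ((‖Φ X‖₊ : ℝ≥0∞)) ^ 2) (X + Pi.single i (EuclideanSpace.single k L)) =
          (fun X => Wt X * ((‖Φ X‖₊ : ℝ≥0∞)) ^ 2) X := fun X i k => by
      simp only [hWper X i k, hper X i k]
    have h := lintegral_cellN_comp_add hL (G := fun X => Wt X * ((‖Φ X‖₊ : ℝ≥0∞)) ^ 2) hG
      (fun _ => s)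
    rw [← h]
    refine lintegral_congr fun X => ?_
    rw [show (X + fun _ => s) = (fun i => X i + s) from rfl, hWinv]
  simp_rw [hinner]
  rw [setLIntegral_const, volume_cell, mul_comm _ (ENNReal.ofReal L ^ 3), ← mul_assoc,
    ENNReal.inv_mul_cancel hL3 hL3', one_mul]

/-- Parseval for the centre-of-mass components, unweighted: `∑_q ∫_{cell^M} |Φ_q|² = ∫_{cell^M} |Φ|²`
for continuous `Φ` periodic in every particle. [folklore] -/
theorem tsum_lintegral_sq_comCoeff (hL : 0 < L) {Φ : Config M → ℂ} (hc : Continuous Φ)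
    (hper : IsTorusPeriodic L Φ) :
    ∑' q : Fin 3 → ℤ, ∫⁻ X in cellN M L, ((‖comCoeff L Φ q X‖₊ : ℝ≥0∞)) ^ 2 =
      ∫⁻ X in cellN M L, ((‖Φ X‖₊ : ℝ≥0∞)) ^ 2 := by
  have h := tsum_lintegral_mul_sq_comCoeff hL hc hper (Wt := fun _ => 1) measurable_const
    (fun _ _ _ => rfl) (fun _ _ => rfl)
  simpa only [one_mul] using h

/-- E1c (Parseval, norm): `∑_q ‖Ψ_q‖² = ‖Ψ‖²` for a core `Ψ` (Parseval on the cell in `s` for each `X`, Tonelli,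
shift invariance of the cell integral of the periodic `X ↦ |Ψ(X + s𝟙)|²`). -/
theorem tsum_normSq_comCoeff (hL : 0 < L) {Ψ : Config M → ℂ} (hΨ : IsCore L Ψ) :
    ∑' q : Fin 3 → ℤ, normSq L (comCoeff L Ψ q) = normSq L Ψ :=
  tsum_lintegral_sq_comCoeff hL hΨ.contDiff.continuous hΨ.periodic

/-- The periodic pair interaction of a measurable profile is measurable. [folklore] -/
private theorem measurable_periodicInteraction_com {w : ℝ → ℝ≥0∞} (hw : Measurable w) (L : ℝ) :
    Measurable fun X : Config M => periodicInteraction w L X := by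
  have hp : Measurable (periodizedPotential w L) := by
    show Measurable fun x => ∑' n : Fin 3 → ℤ, w ‖x - latticeVec L n‖
    exact Measurable.tsum fun n => hw.comp (measurable_id.sub_const _).norm
  unfold periodicInteraction
  refine Finset.measurable_sum _ fun i _ => Finset.measurable_sum _ fun j _ => ?_
  exact hp.comp ((measurable_pi_apply i).sub (measurable_pi_apply j))

/-- E1e (Parseval, potential): `∑_q ∫ W|Ψ_q|² = ∫ W|Ψ|²` for a core `Ψ` and measurable `w` (`W(X + s𝟙) = W(X)`). -/
theorem tsum_lintegral_pot_comCoeff (hL : 0 < L) {w : ℝ → ℝ≥0∞} (hw : Measurable w) {Ψ : Config M → ℂ}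
    (hΨ : IsCore L Ψ) :
    ∑' q : Fin 3 → ℤ, ∫⁻ X in cellN M L, periodicInteraction w L X * ((‖comCoeff L Ψ q X‖₊ : ℝ≥0∞)) ^ 2 =
      ∫⁻ X in cellN M L, periodicInteraction w L X * ((‖Ψ X‖₊ : ℝ≥0∞)) ^ 2 :=
  tsum_lintegral_mul_sq_comCoeff hL hΨ.contDiff.continuous hΨ.periodic
    (measurable_periodicInteraction_com hw L) (fun X i k => periodicInteraction_add_single w L X i k)
    (fun X s => periodicInteraction_add_const w L X s)

/-! ### The derivative formula `∂(Ψ_q) = (∂Ψ)_q` and E1d -/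

/-- The linear map `(s, X) ↦ X + s·𝟙`. [folklore] -/
def comShiftCLM (M : ℕ) : Space × Config M →L[ℝ] Config M :=
  ContinuousLinearMap.pi fun i =>
    (ContinuousLinearMap.proj i).comp (ContinuousLinearMap.snd ℝ Space (Config M)) +
      ContinuousLinearMap.fst ℝ Space (Config M)

/-- `comShiftCLM M (s, X) = X + s·𝟙`. [folklore] -/
theorem comShiftCLM_apply (p : Space × Config M) : comShiftCLM M p = fun i => p.2 i + p.1 := rfl

/-- The derivative of the integrand `(s, X) ↦ e_{-q}(s) Ψ(X + s·𝟙)` of `Ψ_q` (product and chain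
rules). [folklore] -/
theorem hasFDerivAt_comIntegrand {Ψ : Config M → ℂ} (hΨ : ContDiff ℝ 1 Ψ) (q : Fin 3 → ℤ) (s : Space)
    (X : Config M) :
    HasFDerivAt (fun p : Space × Config M => cellWave L (-q) p.1 * Ψ (fun i => p.2 i + p.1))
      (cellWave L (-q) s • (fderiv ℝ Ψ (fun i => X i + s)).comp (comShiftCLM M) +
        Ψ (fun i => X i + s) •
          (fderiv ℝ (cellWave L (-q)) s).comp (ContinuousLinearMap.fst ℝ Space (Config M)))
      (s, X) := by
  have h1 := (((contDiff_cellWave L (-q)).differentiable (by simp)) s).hasFDerivAt.comp (s, X)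
    (hasFDerivAt_fst (𝕜 := ℝ) (E := Space) (F := Config M))
  have hA : HasFDerivAt (fun p : Space × Config M => (fun i => p.2 i + p.1 : Config M))
      (comShiftCLM M) (s, X) :=
    (comShiftCLM M).hasFDerivAt
  have h2 : HasFDerivAt (fun p : Space × Config M => Ψ (fun i => p.2 i + p.1))
      ((fderiv ℝ Ψ (fun i => X i + s)).comp (comShiftCLM M)) (s, X) :=
    HasFDerivAt.comp (s, X) ((hΨ.differentiable one_ne_zero) _).hasFDerivAt hA
  exact h1.mul h2

/-- **The derivative formula** `D(Ψ_q)(X) v = (DΨ(·) v)_q (X)`: differentiation under the integral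
sign over the bounded cell (`fderiv_parametric_setIntegral_apply`). [folklore] -/
theorem fderiv_comCoeff (hL : 0 < L) {Ψ : Config M → ℂ} (hΨ : ContDiff ℝ 1 Ψ) (q : Fin 3 → ℤ)
    (X v : Config M) :
    fderiv ℝ (comCoeff L Ψ q) X v = comCoeff L (fun Y => fderiv ℝ Ψ Y v) q X := by
  have hH := contDiff_comIntegrand_aux (L := L) hΨ q
  have heq : comCoeff L Ψ q = fun X => (((L ^ 3)⁻¹ : ℝ) : ℂ) *
      ∫ s in cell L, cellWave L (-q) s * Ψ (fun i => X i + s) :=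
    funext fun X => comCoeff_eq_integral_aux hL Ψ q X
  have hd : Differentiable ℝ fun X : Config M =>
      ∫ s in cell L, cellWave L (-q) s * Ψ (fun i => X i + s) :=
    Literature.Analysis.FunctionSpaces.differentiable_parametric_setIntegral
      (μ := (volume : Measure Space)) (isBounded_cell L) (measurableSet_cell L) hH one_ne_zero
  have happ := Literature.Analysis.FunctionSpaces.fderiv_parametric_setIntegral_apply
    (μ := (volume : Measure Space)) (isBounded_cell L) (measurableSet_cell L) hH one_ne_zero X v
  rw [heq, fderiv_const_mul (hd X), smul_apply, smul_eq_mul, happ, comCoeff_eq_integral_aux hL]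
  congr 1
  refine setIntegral_congr_fun (measurableSet_cell L) fun s _ => ?_
  rw [(hasFDerivAt_comIntegrand hΨ q s X).fderiv]
  simp only [add_apply, smul_apply, ContinuousLinearMap.coe_comp, Function.comp_apply,
    ContinuousLinearMap.coe_fst', map_zero, mul_zero, add_zero, smul_eq_mul, comShiftCLM_apply]

/-- Partial derivatives of a function periodic in every particle are periodic in every particle. [folklore] -/
theorem isTorusPeriodic_fderiv_apply {Ψ : Config M → ℂ} (hper : IsTorusPeriodic L Ψ) (v : Config M) :
    IsTorusPeriodic L (fun Y => fderiv ℝ Ψ Y v) := by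
  intro X i k
  have h : (fun Y => Ψ (Y + Pi.single i (EuclideanSpace.single k L))) = Ψ :=
    funext fun Y => hper Y i k
  show fderiv ℝ Ψ (X + Pi.single i (EuclideanSpace.single k L)) v = fderiv ℝ Ψ X v
  rw [← fderiv_comp_add_right, h]

/-- E1d (Parseval, kinetic): `∑_q ∫|∇Ψ_q|² = ∫|∇Ψ|²` for a core `Ψ` (`∂_{i,c}Ψ_q = (∂_{i,c}Ψ)_q`: differentiation under the
integral sign, then E1c-type Parseval for the continuous slice of `∂_{i,c}Ψ`). -/
theorem tsum_lintegral_kineticDensity_comCoeff (hL : 0 < L) {Ψ : Config M → ℂ} (hΨ : IsCore L Ψ) :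
    ∑' q : Fin 3 → ℤ, ∫⁻ X in cellN M L, kineticDensity (comCoeff L Ψ q) X = ∫⁻ X in cellN M L, kineticDensity Ψ X := by
  -- the partial derivatives `∂_{i,c}Ψ`, indexed by `p = (i, c)`
  set D : Fin M × Fin 3 → Config M → ℂ := fun p Y =>
    fderiv ℝ Ψ Y (Pi.single p.1 (EuclideanSpace.single p.2 (1 : ℝ))) with hD
  have hDc : ∀ p, Continuous (D p) := fun p => continuous_fderiv_config_single hΨ.contDiff p.1 p.2
  have hDper : ∀ p, IsTorusPeriodic L (D p) := fun p => isTorusPeriodic_fderiv_apply hΨ.periodic _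
  have hkinq : ∀ (q : Fin 3 → ℤ) (X : Config M), kineticDensity (comCoeff L Ψ q) X =
      ∑ p : Fin M × Fin 3, ((‖comCoeff L (D p) q X‖₊ : ℝ≥0∞)) ^ 2 := by
    intro q X
    rw [kineticDensity, ← Fintype.sum_prod_type']
    simp only [fderiv_comCoeff hL hΨ.contDiff, hD]
  have hkin : ∀ X : Config M, kineticDensity Ψ X = ∑ p : Fin M × Fin 3, ((‖D p X‖₊ : ℝ≥0∞)) ^ 2 := by
    intro X
    rw [kineticDensity, ← Fintype.sum_prod_type']
  simp_rw [hkinq, hkin]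
  have hmeas : ∀ p q, Measurable fun X => ((‖comCoeff L (D p) q X‖₊ : ℝ≥0∞)) ^ 2 := fun p q =>
    (continuous_comCoeff hL (hDc p) q).measurable.nnnorm.coe_nnreal_ennreal.pow_const _
  rw [lintegral_finsetSum _ fun p _ => (hDc p).measurable.nnnorm.coe_nnreal_ennreal.pow_const _]
  simp_rw [lintegral_finsetSum _ fun p _ => hmeas p _]
  rw [Summable.tsum_finsetSum (fun p _ => ENNReal.summable)]
  exact Finset.sum_congr rfl fun p _ => tsum_lintegral_sq_comCoeff hL (hDc p) (hDper p)

end Summit.AtomisticToContinuum.BoseEinsteinCondensation.Cruxes.PeriodicIRBound.LinearPhFloorWagner.WF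

end

namespace Summit.AtomisticToContinuum.BoseEinsteinCondensation.Cruxes.PeriodicIRBound.LinearPhFloorWagner

/-- The registered sub-goal `stub_wfComFourier2` of the crux ledger: this file's headline lemma `WF.tsum_normSq_comCoeff`. -/
theorem stub_wfComFourier2 : WF.Pkg.ComFourier2 :=
  @WF.tsum_normSq_comCoeff

end Summit.AtomisticToContinuum.BoseEinsteinCondensation.Cruxes.PeriodicIRBound.LinearPhFloorWagner
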